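/-
Literature/NumberTheory/ComplexMultiplication/DegenerateCMTypesAbelianKernelsIndexTwoPowerOdd.lean — pub-hodgecm2 (COR-CM), KEPT Literature
lane lit-deligne-3 gen 66, file F66j.  THEOREMS ONLY (no `def`, no named fact, no `sorry`, no instance, no notation; D-0026 net debt 0).
HC_CM is NOT proved.
-/
import Literature.NumberTheory.ComplexMultiplication.DegenerateCMTypesAbelianKernels
import Literature.NumberTheory.ComplexMultiplication.DegenerateCMTypesAbelianPrimePower
import Literature.NumberTheory.NumberFields.VanishingSumsRootsOfUnityTwoPowerOdd
import HarnessLib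

/-!
# Kernels of index `2^{k+1}·p₁^{a₁+1}⋯p_{k'}^{a_{k'}+1}` with CYCLIC quotient in a finite abelian group — ANY `2`-part, ANY odd part `> 1`: the characters
# vanish on a CM type iff the `k'`-th MIXED DIFFERENCES of its coset counts along the `p₁⋯p_{k'}`-torsion vanish from every base point

Topic `Literature/NumberTheory/ComplexMultiplication` (namespace `Literature.NumberTheory.ComplexMultiplication.CyclicCMType.AbelianKernels`); cell
`pub-hodgecm2` (COR-CM), KEPT Literature lane `lit-deligne-3` gen 66, file F66j — THE GENERAL KERNEL DECISION of the lane's abelian programme: every admissible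
kernel `H ∌ ρ` (cyclic quotient) of a finite abelian group has index `2^{k+1}·m`, `m` odd; for `m > 1` this file decides the vanishing of its characters on a CM
type (`m = 1`: the `2`-power kernels, decided by equidistribution — tree `…iff_of_index_two`, `…iff_of_index_four`, `AbelianTwoPower.equidistributed_of_sum_eq_zero`).
The cases `k = 0, 1` are the lane's F66c, F66d.  KERNEL ONLY: theorems; no `def`, no named fact, no instance, no notation (D-0014 ∕ D-0026 net debt `0`).
HC_CM is NOT proved here or anywhere in the lane.

## Mathematics

T. Kubota [Kubota1965] §4 Lemma 2 reduces the rank of a CM type `S ⊂ G` to the vanishing of the odd character sums `χ(S)`, grouped by kernels `H = ker χ`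
(`G/H` cyclic, `ρ ∉ H`; tree `AbelianKernels.forall_sum_char_eq_zero_iff_exists`).  For `[G:H] = 2^{k+1}m`, `m = Πp_i^{a_i+1} > 1` odd, `G/H = ⟨σ̄⟩`: put
`w = σ^m` (`χ(w) = ω` primitive of order `2^{k+1}`, `ω^{2^k} = −1 = χ(ρ)`) and `u_i = σ^{[G:H]/p_i^{a_i+1}}` (`χ(u_i) = μ_i` primitive of order `p_i^{a_i+1}`).
The map `ℤ/2 × ℤ/2^k × Πℤ/p_i^{a_i+1} → G/H`, `(ε, e, x) ↦ ρ^ε w^e Πu_i^{x_i}`, is a bijection (its `χ`-values `(−1)^ε ω^e Πμ_i^{x_i}` are pairwise distinct), so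
F. Hazama's computation [Hazama2003CyclicCM] (4.1) with multiplicities reads

  `χ(S) = Σ_{e<2^k} ω^e · Σ_x E_e(x) Πμ_i^{x_i}`,   `E_e(x) = N(ω^eΠμ^x) − N(−ω^eΠμ^x) = 2N(ω^eΠμ^x) − |H|`

(`N(z) = #{s ∈ S : χ(s) = z}`; `S ⊔ ρS = G`).  The inner sums lie in `ℚ(ζ_m)` and `1, ω, …, ω^{2^k−1}` are linearly independent over `ℚ(ζ_m)` ([Washington1997]
Thm. 2.5, Prop. 2.4; the lane's F66i), so `χ(S) = 0` iff every inner sum vanishes, iff (Rédei ∕ de Bruijn ∕ Schoenberg, [LamLeung2000] Thm. 2.2; the lane's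
F66b) every `E_e` — equivalently every count `N(ω^e ·)`, then by complementarity every `N(−ω^e ·)` — has vanishing `k'`-th mixed differences along the admissible
displacements (`p_i d_i = 0`, i.e. `x_i^{p_i} ∈ H`).  Hence (**`sum_char_eq_zero_iff_alternatingSum_of_index_two_pow_mul_primePowers`**):

  `χ(S) = 0 ⟺ Σ_{ε ∈ {0,1}^{k'}} (−1)^{|ε|} #(S ∩ g·x₁^{ε₁}⋯x_{k'}^{ε_{k'}}·H) = 0`  for all `g ∈ G` and all `x_i ∈ G` with `x_i^{p_i} ∈ H`,

the all-characters form **`forall_…`** (the kernel contributes `φ(2^{k+1}m) = 2^kφ(m)` to Kubota's defect iff so), the family form `…_fintype`, and the form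
indexed by the prime divisors of the odd part **`…_of_index_two_pow_mul_odd`** (`[G:H] = 2^{k+1}n`, `n > 1` odd).

* §0 private helpers (suffix `_tp`): character algebra, `exists_family_tp` (`u_i`, `w`), `pow_val_add_tp`, **`coords_eq_of_value_eq_tp`** (cancellation in
  `μ_{2^{k+1}}·Πμ_{p_i^{a_i+1}}` by the power `2^{k+1}Π_{j≠i}p_j^{a_j+1}`), `sum_sign_eq_zero_tp`.
* §1 the parametrisation and fibre sum (`Finset.sum_fiberwise_of_maps_to`; tree `AbelianPrimePow.card_filter_neg`, `card_fibre_mul`), the decomposition over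
  `Fin 2 × (Fin 2^k × Π ZMod (p_i^{a_i+1}))`, F66i, and the dictionary value counts ↔ coset counts (`χ(g·Π_{ε_i}x_i) = ±ω^e Πμ_i^{b_i + ε_i d_i}`).
* §3 `…_fintype` (transport along `Fintype.equivFin ι`); §4 `…_of_index_two_pow_mul_odd` (`Nat.prod_factorization_pow_eq_self`).

PRESEARCH (lane rule): as for F66c ∕ F66d ∕ F66i — the ingredients are Kubota's Lemma 2, Hazama's (4.1) ∕ Lemma 4.6.1 mechanism, [Washington1997] Ch. 2 and
[LamLeung2000] Thm. 2.2 [corpus: paper:arxiv-math_9511209 p0034]; the mixed-difference criterion for a general cyclic quotient is not found as printed (corpus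
hybrid + galaxy «degenerate CM type | rank of a CM-type | index of degeneracy», all stars, lane queries gen 64–66: 0 relevant); recorded as the lane's own
elementary theorem with those citations.

HONEST REGISTER.  Unconditional and elementary; nothing about degenerate types' Hodge classes.  The quotient is ASSUMED cyclic; the odd part must be `> 1`
(`k' ≥ 1`).  HC_CM is NOT proved and not used.

## References

* [Hazama2003CyclicCM] F. Hazama, *Hodge cycles on abelian varieties with complex multiplication by cyclic CM-fields*, J. Math. Sci. Univ. Tokyo 10
  (2003) 581–598: (4.1), Prop. 4.1, 4.3, Lemma 4.6.1 with (4.6)–(4.10), Thm. 4.8.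
* [Kubota1965] T. Kubota, *On the field extension by complex multiplication*, Trans. AMS 118 (1965), §4 Lemma 2.
* [White1993SporadicCycles] S. P. White, *Sporadic cycles on CM abelian varieties*, Compositio Math. 88 (1993), §4, proof of Lemma 3 (p. 131).
* [Washington1997] L. C. Washington, *Introduction to Cyclotomic Fields*, 2nd ed., GTM 83, Ch. 2: Prop. 2.4, Thm. 2.5.
* [LamLeung2000] T. Y. Lam, K. H. Leung, *On vanishing sums of roots of unity*, J. Algebra 224 (2000), Thm. 2.2 (via the lane's F66b ∕ F66i).

## Provenance

Cell `pub-hodgecm2` (COR-CM), KEPT Literature lane `lit-deligne-3` gen 66 (claim ABELIAN-KERNELS-INDEX-GENERAL; count-neutral, own lane), file F66j; neighbours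
cited by name, nothing restated: `DegenerateCMTypesAbelianKernels` (`forall_sum_char_eq_zero_iff_exists`, `exists_oddChar_ker`), `DegenerateCMTypesAbelianPrimePower`
(`AbelianPrimePow.card_filter_neg`, `card_fibre_mul`), `NumberFields/VanishingSumsRootsOfUnityTwoPowerOdd` (F66i: the criterion).  The proof text is the lane's
F66c with the extra base-point coordinate `e ∈ Fin 2^k`; the `[folklore]` helpers are private copies.  Theorems only; net Literature debt 0.
-/

noncomputable section

open scoped BigOperators Classical

namespace Literature.NumberTheory.ComplexMultiplication

namespace CyclicCMType

namespace AbelianKernels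

open Literature.NumberTheory.NumberFields.VanishingSumsTwoPowerOdd (sum_pow_mul_sum_eq_zero_iff_forall_alternatingSum)

variable {G : Type*} [CommGroup G] [Fintype G] [DecidableEq G] {ρ : G} {Φ : Finset G}

/-! ## §0 Helpers -/

section Helpers

omit [Fintype G] [DecidableEq G] in
/-- `χ(gh) = χ(g)χ(h)`. [folklore] -/
private theorem char_mul_tp (χ : AddChar (Additive G) ℂ) (g h : G) :
    χ (Additive.ofMul (g * h)) = χ (Additive.ofMul g) * χ (Additive.ofMul h) := by
  rw [ofMul_mul, AddChar.map_add_eq_mul]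

omit [Fintype G] [DecidableEq G] in
/-- `χ(g^e) = χ(g)^e`. [folklore] -/
private theorem char_pow_tp (χ : AddChar (Additive G) ℂ) (g : G) (e : ℕ) :
    χ (Additive.ofMul (g ^ e)) = χ (Additive.ofMul g) ^ e := by
  rw [ofMul_pow, AddChar.map_nsmul_eq_pow]

omit [Fintype G] [DecidableEq G] in
/-- `χ(1) = 1`. [folklore] -/
private theorem char_one_tp (χ : AddChar (Additive G) ℂ) : χ (Additive.ofMul (1 : G)) = 1 := by
  rw [ofMul_one, AddChar.map_zero_eq_one]

omit [Fintype G] [DecidableEq G] in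
/-- `χ(Π g_i) = Π χ(g_i)`. [folklore] -/
private theorem char_prod_tp {ι : Type*} (χ : AddChar (Additive G) ℂ) (s : Finset ι) (g : ι → G) :
    χ (Additive.ofMul (∏ i ∈ s, g i)) = ∏ i ∈ s, χ (Additive.ofMul (g i)) := by
  induction s using Finset.induction_on with
  | empty => rw [Finset.prod_empty, Finset.prod_empty, char_one_tp]
  | insert a s ha ih => rw [Finset.prod_insert ha, Finset.prod_insert ha, char_mul_tp, ih]

omit [Fintype G] [DecidableEq G] in
/-- `χ(g) ≠ 0`. [folklore] -/
private theorem char_ne_zero_tp (χ : AddChar (Additive G) ℂ) (g : G) : χ (Additive.ofMul g) ≠ 0 := by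
  intro h0
  have := char_mul_tp χ g g⁻¹
  rw [mul_inv_cancel, char_one_tp, h0, zero_mul] at this
  exact one_ne_zero this

omit [Fintype G] [DecidableEq G] in
/-- `χ(s) = χ(g)` iff `g⁻¹s ∈ ker χ`. [folklore] -/
private theorem char_eq_iff_inv_mul_mem_tp {H : Subgroup G} (χ : AddChar (Additive G) ℂ)
    (hker : ∀ g : G, χ (Additive.ofMul g) = 1 ↔ g ∈ H) (g s : G) :
    χ (Additive.ofMul s) = χ (Additive.ofMul g) ↔ g⁻¹ * s ∈ H := by
  rw [← hker]
  have h1 : χ (Additive.ofMul (g⁻¹ * s)) * χ (Additive.ofMul g) = χ (Additive.ofMul s) := by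
    rw [← char_mul_tp, mul_comm g⁻¹ s, inv_mul_cancel_right]
  constructor
  · intro hs
    rw [hs] at h1
    exact mul_left_eq_self₀.1 h1 |>.resolve_right (char_ne_zero_tp χ g)
  · intro h
    rw [h, one_mul] at h1
    exact h1.symm

omit [Fintype G] [DecidableEq G] in
/-- `ρ² = 1` for the conjugation of a CM type. [folklore] -/
private theorem rho_mul_rho_tp (h : IsCMTypeWith ρ (Φ : Set G)) : ρ * ρ = 1 := by
  simpa [smul_eq_mul] using h.invol (1 : G)

omit [Fintype G] [DecidableEq G] in
/-- A character whose kernel misses the involution `ρ` is odd. [folklore] -/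
private theorem odd_of_ker_tp {H : Subgroup G} (hρH : ρ ∉ H) (hρ2 : ρ * ρ = 1) (χ : AddChar (Additive G) ℂ)
    (hker : ∀ g : G, χ (Additive.ofMul g) = 1 ↔ g ∈ H) : χ (Additive.ofMul ρ) = -1 := by
  have hsq : χ (Additive.ofMul ρ) * χ (Additive.ofMul ρ) = 1 := by rw [← char_mul_tp, hρ2, char_one_tp]
  rcases mul_self_eq_one_iff.1 hsq with h1 | h1
  · exact absurd ((hker ρ).1 h1) hρH
  · exact h1

omit [Fintype G] [DecidableEq G] in
/-- For `ker χ` of index `2^{k+1}·p₁^{a₁+1}⋯p_{k'}^{a_{k'}+1}` with cyclic quotient there are elements `u_i` whose `χ`-values are primitive `p_i^{a_i+1}`-th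
roots of unity (`u_i = σ^{n/p_i^{a_i+1}}`) and `w` whose `χ`-value is a primitive `2^{k+1}`-th root of unity (`w = σ^{m}`), `σ` a generator of `G/H`.
[folklore] -/
private theorem exists_family_tp [Finite G] {k k' : ℕ} {p a : Fin k' → ℕ} (hp : ∀ i, (p i).Prime) {H : Subgroup G}
    (χ : AddChar (Additive G) ℂ) (hker : ∀ g : G, χ (Additive.ofMul g) = 1 ↔ g ∈ H) (hidx : H.index = 2 ^ (k + 1) * ∏ i, p i ^ (a i + 1))
    (hcyc : IsCyclic (G ⧸ H)) : ∃ (u : Fin k' → G) (w : G), (∀ i, IsPrimitiveRoot (χ (Additive.ofMul (u i))) (p i ^ (a i + 1))) ∧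
      IsPrimitiveRoot (χ (Additive.ofMul w)) (2 ^ (k + 1)) := by
  haveI := hcyc
  obtain ⟨γ, hγ⟩ := IsCyclic.exists_generator (α := G ⧸ H)
  obtain ⟨σ, rfl⟩ := QuotientGroup.mk_surjective γ
  have hσN : orderOf (σ : G ⧸ H) = 2 ^ (k + 1) * ∏ i, p i ^ (a i + 1) := by
    rw [orderOf_eq_card_of_forall_mem_zpowers hγ, ← Subgroup.index_eq_card, hidx]
  have hprim : IsPrimitiveRoot (χ (Additive.ofMul σ)) (2 ^ (k + 1) * ∏ i, p i ^ (a i + 1)) := by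
    rw [IsPrimitiveRoot.iff_def]
    have hk : ∀ n : ℕ, χ (Additive.ofMul σ) ^ n = 1 ↔ 2 ^ (k + 1) * ∏ i, p i ^ (a i + 1) ∣ n := fun n => by
      rw [← char_pow_tp, hker, ← QuotientGroup.eq_one_iff, QuotientGroup.mk_pow, ← hσN, orderOf_dvd_iff_pow_eq_one]
    exact ⟨(hk _).2 dvd_rfl, fun l hl => (hk l).1 hl⟩
  have hpos : 0 < 2 ^ (k + 1) * ∏ i, p i ^ (a i + 1) := Nat.mul_pos (by positivity) (Finset.prod_pos fun i _ => pow_pos (hp i).pos _)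
  refine ⟨fun i => σ ^ (2 ^ (k + 1) * ∏ j ∈ Finset.univ.erase i, p j ^ (a j + 1)), σ ^ (∏ i, p i ^ (a i + 1)), fun i => ?_, ?_⟩
  · rw [char_pow_tp]
    exact hprim.pow hpos (by rw [mul_assoc, Finset.prod_erase_mul _ _ (Finset.mem_univ i)])
  · rw [char_pow_tp]
    exact hprim.pow hpos (by rw [mul_comm])

/-- `ω^{(x + y).val} = ω^{x.val} ω^{y.val}` for `ω` a primitive `n`-th root of unity. [folklore] -/
private theorem pow_val_add_tp {n : ℕ} [NeZero n] {ω : ℂ} (hω : IsPrimitiveRoot ω n) (x y : ZMod n) :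
    ω ^ (x + y).val = ω ^ x.val * ω ^ y.val := by
  have h1 := pow_mod_orderOf ω (x.val + y.val)
  rw [← hω.eq_orderOf] at h1
  rw [ZMod.val_add, h1, pow_add]

/-- **Cancellation in `μ_{2^{k+1}} · μ_{p₁^{a₁+1}} ⋯ μ_{p_{k'}^{a_{k'}+1}}`** (pairwise distinct odd primes): `z Π μ_i^{x_i} = z' Π μ_i^{x'_i}` with
`z^{2^{k+1}} = z'^{2^{k+1}} = 1` forces `x = x'` (raise to the power `2^{k+1}·Π_{j ≠ i} p_j^{a_j+1}`, which kills every factor but the `i`-th and is invertible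
modulo `p_i^{a_i+1}`). [folklore] -/
private theorem coords_eq_of_value_eq_tp {k k' : ℕ} {p a : Fin k' → ℕ} [∀ i, NeZero (p i ^ (a i + 1))] (hp : ∀ i, (p i).Prime)
    (hinj : Function.Injective p) (hodd : ∀ i, p i ≠ 2) {μ : Fin k' → ℂ} (hμ : ∀ i, IsPrimitiveRoot (μ i) (p i ^ (a i + 1)))
    {z z' : ℂ} (hz : z ^ 2 ^ (k + 1) = 1) (hz' : z' ^ 2 ^ (k + 1) = 1) {x x' : Π i, ZMod (p i ^ (a i + 1))}
    (h : z * ∏ i, μ i ^ (x i).val = z' * ∏ i, μ i ^ (x' i).val) : x = x' := by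
  funext i
  set N : ℕ := 2 ^ (k + 1) * ∏ j ∈ Finset.univ.erase i, p j ^ (a j + 1) with hN
  have hkill : ∀ (c : ℂ) (_ : c ^ 2 ^ (k + 1) = 1) (y : Π i, ZMod (p i ^ (a i + 1))), (c * ∏ j, μ j ^ (y j).val) ^ N = μ i ^ (N * (y i).val) := by
    intro c hc y
    have A : c ^ N = 1 := by
      rw [hN, pow_mul, hc, one_pow]
    have B : (∏ j, μ j ^ (y j).val) ^ N = μ i ^ (N * (y i).val) := by
      rw [← Finset.prod_pow, Finset.prod_eq_single i]
      · rw [← pow_mul, mul_comm]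
      · intro j _ hji
        have hsplit : p j ^ (a j + 1) * ∏ l ∈ (Finset.univ.erase i).erase j, p l ^ (a l + 1) =
            ∏ l ∈ Finset.univ.erase i, p l ^ (a l + 1) :=
          Finset.mul_prod_erase (Finset.univ.erase i) (fun l => p l ^ (a l + 1)) (Finset.mem_erase.2 ⟨hji, Finset.mem_univ j⟩)
        rw [← pow_mul, hN, ← hsplit, show (y j).val * (2 ^ (k + 1) * (p j ^ (a j + 1) * ∏ l ∈ (Finset.univ.erase i).erase j, p l ^ (a l + 1))) =
            p j ^ (a j + 1) * (2 ^ (k + 1) * (y j).val * ∏ l ∈ (Finset.univ.erase i).erase j, p l ^ (a l + 1)) by ring, pow_mul, (hμ j).pow_eq_one,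
          one_pow]
      · intro hi; exact absurd (Finset.mem_univ i) hi
    rw [mul_pow, A, B, one_mul]
  have h2 : μ i ^ (N * (x i).val) = μ i ^ (N * (x' i).val) := by rw [← hkill z hz x, ← hkill z' hz' x', h]
  have hpi := hp i
  have hqi : 0 < p i ^ (a i + 1) := pow_pos hpi.pos _
  have hmod : N * (x i).val ≡ N * (x' i).val [MOD p i ^ (a i + 1)] := by
    have h1 := pow_mod_orderOf (μ i) (N * (x i).val)
    have h1' := pow_mod_orderOf (μ i) (N * (x' i).val)
    rw [← (hμ i).eq_orderOf] at h1 h1'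
    rw [← h1, ← h1'] at h2
    exact (hμ i).pow_inj (Nat.mod_lt _ hqi) (Nat.mod_lt _ hqi) h2
  have hzz : ((N * (x i).val : ℕ) : ZMod (p i ^ (a i + 1))) = ((N * (x' i).val : ℕ) : ZMod (p i ^ (a i + 1))) :=
    (ZMod.natCast_eq_natCast_iff _ _ _).2 hmod
  push_cast at hzz
  rw [ZMod.natCast_zmod_val, ZMod.natCast_zmod_val] at hzz
  have hu : IsUnit ((N : ℕ) : ZMod (p i ^ (a i + 1))) := by
    rw [ZMod.isUnit_iff_coprime, hN]
    refine Nat.Coprime.pow_right _ ?_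
    exact Nat.Coprime.mul_left (Nat.Coprime.pow_left _ ((Nat.coprime_primes Nat.prime_two hpi).2 (Ne.symm (hodd i))))
      (Nat.Coprime.prod_left fun j hj => Nat.Coprime.pow_left _ ((Nat.coprime_primes (hp j) hpi).2
        fun hji => (Finset.mem_erase.1 hj).1 (hinj hji)))
  exact hu.mul_left_cancel hzz

/-- `Σ_{ε ∈ {0,1}^k} Π_i (±1) = Π_i (−1 + 1) = 0` for `k ≥ 1`. [folklore] -/
private theorem sum_sign_eq_zero_tp {k' : ℕ} (hk : 0 < k') :
    ∑ ε : Fin k' → Bool, (∏ i, (if ε i then (-1 : ℚ) else 1)) = 0 := by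
  rw [← Fintype.prod_sum fun (_ : Fin k') (b : Bool) => if b then (-1 : ℚ) else 1]
  exact Finset.prod_eq_zero (Finset.mem_univ (⟨0, hk⟩ : Fin k')) (by rw [Fintype.sum_bool]; norm_num)

end Helpers

/-! ## §1 Kernels of index `2^{k+1}·p₁^{a₁+1}⋯p_{k'}^{a_{k'}+1}` with cyclic quotient: the character sum over `Fin 2 × (Fin 2^k × Π ℤ/p_i^{a_i+1})` and the
vanishing criterion -/

section IndexTwoPowerOdd

/-- **VANISHING AT A KERNEL OF INDEX `2^{k+1}·p₁^{a₁+1}⋯p_{k'}^{a_{k'}+1}` (CYCLIC QUOTIENT, ANY `2`-PART) IS THE VANISHING OF THE `k'`-TH MIXED DIFFERENCES OF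
THE COSET COUNTS ALONG THE `p₁⋯p_{k'}`-TORSION, FROM EVERY BASE POINT** (any finite abelian group `G ∋ ρ`; `p₁, …, p_{k'}` pairwise distinct ODD primes, any
exponents, `k' ≥ 1`, any `k`): let `χ` be a character whose kernel `H ∌ ρ` has index `2^{k+1}·Πp_i^{a_i+1}` and cyclic quotient, and `S` a CM type.  Then
`χ(S) = 0` iff

  `Σ_{ε ∈ {0,1}^{k'}} (−1)^{|ε|} #(S ∩ g·x₁^{ε₁}⋯x_{k'}^{ε_{k'}}·H) = 0`  for all `g ∈ G` and all `x_i` with `x_i^{p_i} ∈ H`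

— literally the condition of the lane's F66c (`k = 0`) and F66d (`k = 1`).  Mechanism: with `χ(w) = ω` primitive of order `2^{k+1}` and `χ(u_i) = μ_i`
primitive of order `p_i^{a_i+1}`, every value of `χ` is `±ω^e Πμ_i^{x_i}` (`e < 2^k`) and `χ(S) = Σ_{e<2^k} ω^e Σ_x E_e(x) Πμ_i^{x_i}` with
`E_e(x) = N(ω^eΠμ^x) − N(−ω^eΠμ^x) = 2N − |H|`; the `2^k` coordinates over `ℚ(ζ_m)` vanish separately (the lane's F66i: `1, ω, …, ω^{2^k−1}` are linearly
independent over `ℚ(ζ_m)`), and each does iff the mixed differences along admissible displacements vanish (F66b).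
[cite: Kubota1965, §4 Lemma 2] [cite: Hazama2003CyclicCM, Prop. 4.1, Lemma 4.6.1, Thm. 4.8] [cite: Washington1997, Prop. 2.4 and Thm. 2.5] [cite: LamLeung2000, Thm. 2.2] -/
theorem sum_char_eq_zero_iff_alternatingSum_of_index_two_pow_mul_primePowers (k : ℕ) {k' : ℕ} {p a : Fin k' → ℕ} (hk' : 0 < k')
    (hp : ∀ i, (p i).Prime) (hinj : Function.Injective p) (hodd : ∀ i, p i ≠ 2)
    (h : IsCMTypeWith ρ (Φ : Set G)) (χ : AddChar (Additive G) ℂ) {H : Subgroup G} (hρH : ρ ∉ H)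
    (hker : ∀ g : G, χ (Additive.ofMul g) = 1 ↔ g ∈ H) (hidx : H.index = 2 ^ (k + 1) * ∏ i, p i ^ (a i + 1)) (hcyc : IsCyclic (G ⧸ H)) :
    ∑ s ∈ Φ, χ (Additive.ofMul s) = 0 ↔ ∀ (g : G) (x : Fin k' → G), (∀ i, x i ^ p i ∈ H) →
      ∑ ε : Fin k' → Bool, (∏ i, (if ε i then (-1 : ℤ) else 1)) *
        ((Φ.filter fun s => (g * ∏ i, (if ε i then x i else 1))⁻¹ * s ∈ H).card : ℤ) = 0 := by
  haveI : ∀ i, NeZero (p i ^ (a i + 1)) := fun i => ⟨pow_ne_zero _ (hp i).ne_zero⟩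
  have hρ2 := rho_mul_rho_tp h
  have hχρ : χ (Additive.ofMul ρ) = -1 := odd_of_ker_tp hρH hρ2 χ hker
  obtain ⟨u, w, hu, hω⟩ := exists_family_tp (k := k) hp χ hker hidx hcyc
  have h2k : 0 < 2 ^ (k + 1) := by positivity
  -- `ω^{2^k} = −1`
  have hωk : χ (Additive.ofMul w) ^ 2 ^ k = -1 := (hω.pow h2k (by ring)).eq_neg_one_of_two_right
  -- the coset counts as value counts
  have hcos : ∀ g : G, (Φ.filter fun s => g⁻¹ * s ∈ H) =
      Φ.filter fun s => χ (Additive.ofMul s) = χ (Additive.ofMul g) := fun g =>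
    Finset.filter_congr fun s _ => (char_eq_iff_inv_mul_mem_tp χ hker g s).symm
  -- the values `χ(w^e Π u_i^{x_i}) = ω^e Π μ_i^{x_i}`
  have hvalu : ∀ x : Π i, ZMod (p i ^ (a i + 1)), χ (Additive.ofMul (∏ i, u i ^ (x i).val)) =
      ∏ i, χ (Additive.ofMul (u i)) ^ (x i).val := fun x => by
    rw [char_prod_tp]
    exact Finset.prod_congr rfl fun i _ => char_pow_tp χ (u i) _
  have hval : ∀ y : Fin (2 ^ k) × (Π i, ZMod (p i ^ (a i + 1))), χ (Additive.ofMul (w ^ (y.1 : ℕ) * ∏ i, u i ^ (y.2 i).val)) =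
      χ (Additive.ofMul w) ^ (y.1 : ℕ) * ∏ i, χ (Additive.ofMul (u i)) ^ (y.2 i).val := fun y => by
    rw [char_mul_tp, char_pow_tp, hvalu]
  -- the fibre sizes over the values are all `M := #χ⁻¹(1)`
  have hM : ∀ y : Fin (2 ^ k) × (Π i, ZMod (p i ^ (a i + 1))),
      (Finset.univ.filter fun t : G => χ (Additive.ofMul t) = χ (Additive.ofMul w) ^ (y.1 : ℕ) * ∏ i, χ (Additive.ofMul (u i)) ^ (y.2 i).val).card =
        (Finset.univ.filter fun t : G => χ (Additive.ofMul t) = 1).card := fun y => by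
    rw [← hval, ← AbelianPrimePow.card_fibre_mul χ (w ^ (y.1 : ℕ) * ∏ i, u i ^ (y.2 i).val) 1, mul_one]
  have hneg : ∀ y : Fin (2 ^ k) × (Π i, ZMod (p i ^ (a i + 1))),
      (Φ.filter fun s => χ (Additive.ofMul s) = -(χ (Additive.ofMul w) ^ (y.1 : ℕ) * ∏ i, χ (Additive.ofMul (u i)) ^ (y.2 i).val)).card =
        (Finset.univ.filter fun t : G => χ (Additive.ofMul t) = 1).card -
          (Φ.filter fun s => χ (Additive.ofMul s) = χ (Additive.ofMul w) ^ (y.1 : ℕ) * ∏ i, χ (Additive.ofMul (u i)) ^ (y.2 i).val).card := by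
    intro y
    rw [AbelianPrimePow.card_filter_neg h χ hχρ, hM]
  have hle : ∀ y : Fin (2 ^ k) × (Π i, ZMod (p i ^ (a i + 1))),
      (Φ.filter fun s => χ (Additive.ofMul s) = χ (Additive.ofMul w) ^ (y.1 : ℕ) * ∏ i, χ (Additive.ofMul (u i)) ^ (y.2 i).val).card ≤
        (Finset.univ.filter fun t : G => χ (Additive.ofMul t) = 1).card := fun y => by
    rw [← hM y]
    exact Finset.card_le_card (Finset.filter_subset_filter _ (Finset.subset_univ Φ))
  -- §A  the character sum is `Σ_y E(y) ω^{y₁} Π μ_i^{y₂ i}` with `E(y) = N(v_y) − N(−v_y)`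
  set E : Fin (2 ^ k) × (Π i, ZMod (p i ^ (a i + 1))) → ℚ := fun y =>
    ((Φ.filter fun s => χ (Additive.ofMul s) = χ (Additive.ofMul w) ^ (y.1 : ℕ) * ∏ i, χ (Additive.ofMul (u i)) ^ (y.2 i).val).card : ℚ) -
      ((Φ.filter fun s => χ (Additive.ofMul s) = -(χ (Additive.ofMul w) ^ (y.1 : ℕ) * ∏ i, χ (Additive.ofMul (u i)) ^ (y.2 i).val)).card : ℚ)
    with hE
  -- the parametrisation of `G/H` by `Fin 2 × (Fin 2^k × Π ℤ/p_i^{a_i+1})`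
  set wf : Fin 2 × (Fin (2 ^ k) × (Π i, ZMod (p i ^ (a i + 1)))) → G := fun t => ρ ^ (t.1 : ℕ) * (w ^ (t.2.1 : ℕ) * ∏ i, u i ^ (t.2.2 i).val)
    with hwf
  set F : Fin 2 × (Fin (2 ^ k) × (Π i, ZMod (p i ^ (a i + 1)))) → ℂ := fun t =>
    (-1 : ℂ) ^ (t.1 : ℕ) * (χ (Additive.ofMul w) ^ (t.2.1 : ℕ) * ∏ i, χ (Additive.ofMul (u i)) ^ (t.2.2 i).val) with hF
  have hFw : ∀ t, χ (Additive.ofMul (wf t)) = F t := fun t => by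
    rw [hwf, hF]
    dsimp only
    rw [char_mul_tp, char_pow_tp, hχρ, hval]
  have hFinj : Function.Injective F := by
    rintro ⟨e, e₀, x⟩ ⟨e', e₀', x'⟩ hFF
    rw [hF] at hFF
    dsimp only at hFF
    rw [← mul_assoc, ← mul_assoc] at hFF
    have hz : ∀ (c : ℕ) (c₀ : ℕ), ((-1 : ℂ) ^ c * χ (Additive.ofMul w) ^ c₀) ^ 2 ^ (k + 1) = 1 := fun c c₀ => by
      rw [mul_pow, ← pow_mul, ← pow_mul, pow_succ, show c * (2 ^ k * 2) = 2 * (c * 2 ^ k) by ring, pow_mul, neg_one_sq, one_pow, one_mul,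
        mul_comm, pow_mul, ← pow_succ, hω.pow_eq_one, one_pow]
    have hx : x = x' := coords_eq_of_value_eq_tp hp hinj hodd hu (hz e e₀) (hz e' e₀') hFF
    subst hx
    have hprod0 : (∏ i, χ (Additive.ofMul (u i)) ^ (x i).val) ≠ 0 :=
      Finset.prod_ne_zero_iff.2 fun i _ => pow_ne_zero _ (char_ne_zero_tp χ (u i))
    have hε : (-1 : ℂ) ^ (e : ℕ) * χ (Additive.ofMul w) ^ (e₀ : ℕ) = (-1 : ℂ) ^ (e' : ℕ) * χ (Additive.ofMul w) ^ (e₀' : ℕ) :=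
      mul_right_cancel₀ hprod0 hFF
    -- `(−1)^e ω^{e₀} = ω^{2^k e + e₀}`
    rw [← hωk, ← pow_mul, ← pow_add, ← pow_mul, ← pow_add] at hε
    have hlt : ∀ (c : Fin 2) (c₀ : Fin (2 ^ k)), 2 ^ k * (c : ℕ) + (c₀ : ℕ) < 2 ^ (k + 1) := fun c c₀ => by
      have h1 := c.isLt; have h2 := c₀.isLt
      rcases Nat.lt_succ_iff.1 h1 |> Nat.le_one_iff_eq_zero_or_eq_one.1 with h0 | h0 <;> rw [h0, pow_succ] <;> omega
    have hee := hω.pow_inj (hlt e e₀) (hlt e' e₀') hε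
    have h1 := e.isLt; have h1' := e'.isLt; have h2 := e₀.isLt; have h2' := e₀'.isLt
    have he : (e : ℕ) = e' := by
      rcases Nat.le_one_iff_eq_zero_or_eq_one.1 (Nat.lt_succ_iff.1 h1) with h0 | h0 <;>
        rcases Nat.le_one_iff_eq_zero_or_eq_one.1 (Nat.lt_succ_iff.1 h1') with h0' | h0' <;> rw [h0, h0'] at hee ⊢ <;> omega
    have he₀ : (e₀ : ℕ) = e₀' := by rw [he] at hee; omega
    rw [Fin.ext he, Fin.ext he₀]
  have hwinj : Function.Injective (fun t => (wf t : G ⧸ H)) := by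
    intro t t' htt
    have hmem : (wf t)⁻¹ * wf t' ∈ H := QuotientGroup.eq.1 htt
    have hχeq : χ (Additive.ofMul (wf t')) = χ (Additive.ofMul (wf t)) := (char_eq_iff_inv_mul_mem_tp χ hker _ _).2 hmem
    rw [hFw, hFw] at hχeq
    exact (hFinj hχeq).symm
  have hcard : Fintype.card (Fin 2 × (Fin (2 ^ k) × (Π i, ZMod (p i ^ (a i + 1))))) = Fintype.card (G ⧸ H) := by
    rw [← Nat.card_eq_fintype_card (α := G ⧸ H), ← Subgroup.index_eq_card, hidx]
    simp [Fintype.card_prod, Fintype.card_pi, ZMod.card, pow_succ]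
    ring
  have hwbij : Function.Bijective (fun t => (wf t : G ⧸ H)) :=
    (Fintype.bijective_iff_injective_and_card _).2 ⟨hwinj, hcard⟩
  -- every value of `χ` is some `F t`, and the fibres of `t ↦ F t` are the value fibres
  have hexists : ∀ s : G, ∃ t, χ (Additive.ofMul s) = F t := fun s => by
    obtain ⟨t, ht⟩ := hwbij.2 (s : G ⧸ H)
    refine ⟨t, ?_⟩
    rw [← hFw]
    exact (char_eq_iff_inv_mul_mem_tp χ hker (wf t) s).2 (QuotientGroup.eq.1 ht)
  have hsumF : ∑ s ∈ Φ, χ (Additive.ofMul s) =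
      ∑ t : Fin 2 × (Fin (2 ^ k) × (Π i, ZMod (p i ^ (a i + 1)))), ((Φ.filter fun s => χ (Additive.ofMul s) = F t).card : ℂ) * F t := by
    rw [← Finset.sum_fiberwise_of_maps_to (s := Φ) (t := Finset.univ)
      (g := fun s => Classical.choose (hexists s)) (fun s _ => Finset.mem_univ _) (fun s => χ (Additive.ofMul s))]
    refine Finset.sum_congr rfl fun t _ => ?_
    have hfib : (Φ.filter fun s => Classical.choose (hexists s) = t) = Φ.filter fun s => χ (Additive.ofMul s) = F t := by
      refine Finset.filter_congr fun s _ => ⟨fun hs => ?_, fun hs => ?_⟩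
      · rw [← hs]; exact Classical.choose_spec (hexists s)
      · exact hFinj ((Classical.choose_spec (hexists s)).symm.trans hs)
    rw [hfib, Finset.sum_congr rfl fun s hs => (Finset.mem_filter.1 hs).2, Finset.sum_const, nsmul_eq_mul]
  have hsumE : ∑ s ∈ Φ, χ (Additive.ofMul s) =
      ∑ e : Fin (2 ^ k), χ (Additive.ofMul w) ^ (e : ℕ) * ∑ x : (Π i, ZMod (p i ^ (a i + 1))),
        algebraMap ℚ ℂ (E (e, x)) * ∏ i, χ (Additive.ofMul (u i)) ^ (x i).val := by
    rw [hsumF, Fintype.sum_prod_type, Fin.sum_univ_two, ← Finset.sum_add_distrib, Fintype.sum_prod_type]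
    refine Finset.sum_congr rfl fun e _ => ?_
    rw [Finset.mul_sum]
    refine Finset.sum_congr rfl fun x _ => ?_
    rw [hE, hF]
    dsimp only
    simp only [Fin.val_zero, Fin.val_one, pow_zero, pow_one, one_mul, neg_one_mul, map_sub, map_natCast]
    ring
  -- §B  the criterion in value form (the `2^k` coordinates over `ℚ(ζ_m)`, then F66b for each)
  rw [hsumE, sum_pow_mul_sum_eq_zero_iff_forall_alternatingSum k hω hk' hp hinj hodd hu (fun e x => E (e, x))]
  have hEval : ∀ y : Fin (2 ^ k) × (Π i, ZMod (p i ^ (a i + 1))), E y =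
      2 * ((Φ.filter fun s => χ (Additive.ofMul s) = χ (Additive.ofMul w) ^ (y.1 : ℕ) * ∏ i, χ (Additive.ofMul (u i)) ^ (y.2 i).val).card : ℚ) -
        ((Finset.univ.filter fun t : G => χ (Additive.ofMul t) = 1).card : ℚ) := by
    intro y
    rw [hE]
    dsimp only
    rw [hneg y, Nat.cast_sub (hle y)]
    ring
  -- the value form of the criterion at base `e`: `Σ_ε (−1)^{|ε|} N(ω^e Π μ_i^{(x + ε d)_i}) = 0`
  have hvalue : (∀ (e : Fin (2 ^ k)) (x d : Π i, ZMod (p i ^ (a i + 1))), (∀ i, p i • d i = 0) →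
        ∑ ε : Fin k' → Bool, (∏ i, (if ε i then (-1 : ℚ) else 1)) * E (e, fun i => if ε i then x i + d i else x i) = 0) ↔
      ∀ (e : Fin (2 ^ k)) (x d : Π i, ZMod (p i ^ (a i + 1))), (∀ i, p i • d i = 0) → ∑ ε : Fin k' → Bool, (∏ i, (if ε i then (-1 : ℚ) else 1)) *
        ((Φ.filter fun s => χ (Additive.ofMul s) =
          χ (Additive.ofMul w) ^ (e : ℕ) * ∏ i, χ (Additive.ofMul (u i)) ^ ((if ε i then x i + d i else x i)).val).card : ℚ) = 0 := by
    have hrw : ∀ (e : Fin (2 ^ k)) (x d : Π i, ZMod (p i ^ (a i + 1))), ∑ ε : Fin k' → Bool, (∏ i, (if ε i then (-1 : ℚ) else 1)) *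
        E (e, fun i => if ε i then x i + d i else x i) =
        2 * ∑ ε : Fin k' → Bool, (∏ i, (if ε i then (-1 : ℚ) else 1)) *
          ((Φ.filter fun s => χ (Additive.ofMul s) =
            χ (Additive.ofMul w) ^ (e : ℕ) * ∏ i, χ (Additive.ofMul (u i)) ^ ((if ε i then x i + d i else x i)).val).card : ℚ) := by
      intro e x d
      simp_rw [hEval]
      rw [Finset.mul_sum]
      have hs := sum_sign_eq_zero_tp hk'
      rw [← sub_eq_zero, ← Finset.sum_sub_distrib]
      have : ∑ ε : Fin k' → Bool, ((∏ i, (if ε i then (-1 : ℚ) else 1)) *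
          (2 * ((Φ.filter fun s => χ (Additive.ofMul s) =
            χ (Additive.ofMul w) ^ (e : ℕ) * ∏ i, χ (Additive.ofMul (u i)) ^ ((if ε i then x i + d i else x i)).val).card : ℚ) -
            ((Finset.univ.filter fun t : G => χ (Additive.ofMul t) = 1).card : ℚ)) -
          2 * ((∏ i, (if ε i then (-1 : ℚ) else 1)) *
            ((Φ.filter fun s => χ (Additive.ofMul s) =
              χ (Additive.ofMul w) ^ (e : ℕ) * ∏ i, χ (Additive.ofMul (u i)) ^ ((if ε i then x i + d i else x i)).val).card : ℚ))) =
          -((Finset.univ.filter fun t : G => χ (Additive.ofMul t) = 1).card : ℚ) *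
            ∑ ε : Fin k' → Bool, (∏ i, (if ε i then (-1 : ℚ) else 1)) := by
        rw [Finset.mul_sum]
        exact Finset.sum_congr rfl fun ε _ => by ring
      rw [this, hs, mul_zero]
    constructor
    · intro hv e x d hd
      have := hv e x d hd
      rw [hrw] at this
      linarith
    · intro hv e x d hd
      rw [hrw, hv e x d hd, mul_zero]
  rw [hvalue]
  -- §C  value counts versus coset counts
  have hN : ∀ g : G, (Φ.filter fun s => g⁻¹ * s ∈ H).card =
      (Φ.filter fun s => χ (Additive.ofMul s) = χ (Additive.ofMul g)).card := fun g => by rw [hcos]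
  -- `χ(g · Π_{ε_i} x_i)` in coordinates
  have hcomb : ∀ (c : ℂ) (b d : Π i, ZMod (p i ^ (a i + 1))) (g : G) (x : Fin k' → G),
      χ (Additive.ofMul g) = c * ∏ i, χ (Additive.ofMul (u i)) ^ (b i).val →
      (∀ i, χ (Additive.ofMul (x i)) = χ (Additive.ofMul (u i)) ^ (d i).val) →
      ∀ ε : Fin k' → Bool, χ (Additive.ofMul (g * ∏ i, (if ε i then x i else 1))) =
        c * ∏ i, χ (Additive.ofMul (u i)) ^ ((if ε i then b i + d i else b i)).val := by
    intro c b d g x hg hx ε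
    rw [char_mul_tp, hg, char_prod_tp, mul_assoc, ← Finset.prod_mul_distrib]
    congr 1
    refine Finset.prod_congr rfl fun i _ => ?_
    by_cases hε : ε i
    · rw [if_pos hε, if_pos hε, hx i, pow_val_add_tp (hu i)]
    · rw [if_neg hε, if_neg hε, char_one_tp, mul_one]
  constructor
  · intro hv g x hx
    -- coordinates of `g` and of the `x_i`
    obtain ⟨⟨e, e₀, b⟩, ht⟩ := hexists g
    rw [hF] at ht
    dsimp only at ht
    have hxp : ∀ i, χ (Additive.ofMul (x i)) ^ p i = 1 := fun i => by rw [← char_pow_tp, hker]; exact hx i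
    have hd : ∀ i, ∃ n : ℕ, n < p i ^ (a i + 1) ∧ χ (Additive.ofMul (u i)) ^ n = χ (Additive.ofMul (x i)) := fun i => by
      have hxq : χ (Additive.ofMul (x i)) ^ (p i ^ (a i + 1)) = 1 := by
        rw [pow_succ', pow_mul, hxp i, one_pow]
      exact (hu i).eq_pow_of_pow_eq_one hxq
    choose n hn hnx using hd
    have hx' : ∀ i, χ (Additive.ofMul (x i)) = χ (Additive.ofMul (u i)) ^ (((n i : ℕ) : ZMod (p i ^ (a i + 1)))).val := fun i => by
      rw [ZMod.val_natCast_of_lt (hn i), hnx]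
    -- the displacements are admissible
    have hadm : ∀ i, p i • ((n i : ℕ) : ZMod (p i ^ (a i + 1))) = 0 := fun i => by
      rw [nsmul_eq_mul, ← Nat.cast_mul, ZMod.natCast_eq_zero_iff, ← (hu i).pow_eq_one_iff_dvd, pow_mul', hnx i]
      exact hxp i
    have key := hv e₀ b (fun i => ((n i : ℕ) : ZMod (p i ^ (a i + 1)))) hadm
    have ht' : χ (Additive.ofMul g) = ((-1 : ℂ) ^ (e : ℕ) * χ (Additive.ofMul w) ^ (e₀ : ℕ)) * ∏ i, χ (Additive.ofMul (u i)) ^ (b i).val := by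
      rw [ht, mul_assoc]
    have hterm : ∀ ε : Fin k' → Bool,
        ((Φ.filter fun s => (g * ∏ i, (if ε i then x i else 1))⁻¹ * s ∈ H).card : ℤ) =
          if (e : ℕ) = 0 then
            ((Φ.filter fun s => χ (Additive.ofMul s) = χ (Additive.ofMul w) ^ (e₀ : ℕ) *
              ∏ i, χ (Additive.ofMul (u i)) ^ ((if ε i then b i + ((n i : ℕ) : ZMod (p i ^ (a i + 1))) else b i)).val).card : ℤ)
          else
            ((Finset.univ.filter fun t : G => χ (Additive.ofMul t) = 1).card : ℤ) -
              ((Φ.filter fun s => χ (Additive.ofMul s) = χ (Additive.ofMul w) ^ (e₀ : ℕ) *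
                ∏ i, χ (Additive.ofMul (u i)) ^ ((if ε i then b i + ((n i : ℕ) : ZMod (p i ^ (a i + 1))) else b i)).val).card : ℤ) := by
      intro ε
      rw [hN, hcomb _ b _ g x ht' hx' ε]
      rcases Fin.exists_fin_two.1 ⟨e, rfl⟩ with he | he
      · simp only [he, Fin.val_zero, pow_zero, one_mul, if_true]
      · simp only [he, Fin.val_one, pow_one, neg_mul, one_mul, one_ne_zero, if_false]
        have := hneg (e₀, fun i => if ε i then b i + ((n i : ℕ) : ZMod (p i ^ (a i + 1))) else b i)
        dsimp only at this
        rw [this, Nat.cast_sub (hle (e₀, _))]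
    simp_rw [hterm]
    rcases Fin.exists_fin_two.1 ⟨e, rfl⟩ with he | he
    · simp only [he, Fin.val_zero, if_true]
      exact_mod_cast key
    · simp only [he, Fin.val_one, one_ne_zero, if_false, mul_sub, Finset.sum_sub_distrib, ← Finset.sum_mul]
      have hs : ∑ ε : Fin k' → Bool, (∏ i, (if ε i then (-1 : ℤ) else 1)) = 0 := by
        exact_mod_cast sum_sign_eq_zero_tp hk'
      have key' : ∑ ε : Fin k' → Bool, (∏ i, (if ε i then (-1 : ℤ) else 1)) *
          ((Φ.filter fun s => χ (Additive.ofMul s) = χ (Additive.ofMul w) ^ (e₀ : ℕ) *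
            ∏ i, χ (Additive.ofMul (u i)) ^ ((if ε i then b i + ((n i : ℕ) : ZMod (p i ^ (a i + 1))) else b i)).val).card : ℤ) = 0 := by
        exact_mod_cast key
      rw [hs, zero_mul, key', sub_zero]
  · intro hcoset e₀ b d hd
    have hx : ∀ i, (u i ^ (d i).val) ^ p i ∈ H := fun i => by
      rw [← hker, char_pow_tp, char_pow_tp, ← pow_mul, (hu i).pow_eq_one_iff_dvd]
      have h1 : ((p i * (d i).val : ℕ) : ZMod (p i ^ (a i + 1))) = 0 := by
        rw [Nat.cast_mul, ZMod.natCast_zmod_val, ← nsmul_eq_mul]; exact hd i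
      rw [mul_comm]
      exact (ZMod.natCast_eq_zero_iff _ _).1 h1
    have key := hcoset (w ^ (e₀ : ℕ) * ∏ i, u i ^ (b i).val) (fun i => u i ^ (d i).val) hx
    have hg : χ (Additive.ofMul (w ^ (e₀ : ℕ) * ∏ i, u i ^ (b i).val)) =
        χ (Additive.ofMul w) ^ (e₀ : ℕ) * ∏ i, χ (Additive.ofMul (u i)) ^ (b i).val := hval (e₀, b)
    have hx' : ∀ i, χ (Additive.ofMul (u i ^ (d i).val)) = χ (Additive.ofMul (u i)) ^ (d i).val := fun i => char_pow_tp χ _ _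
    have hterm : ∀ ε : Fin k' → Bool,
        ((Φ.filter fun s => ((w ^ (e₀ : ℕ) * ∏ i, u i ^ (b i).val) * ∏ i, (if ε i then u i ^ (d i).val else 1))⁻¹ * s ∈ H).card : ℤ) =
          ((Φ.filter fun s => χ (Additive.ofMul s) =
            χ (Additive.ofMul w) ^ (e₀ : ℕ) * ∏ i, χ (Additive.ofMul (u i)) ^ ((if ε i then b i + d i else b i)).val).card : ℤ) := by
      intro ε
      rw [hN, hcomb _ b d _ _ hg hx' ε]
    simp_rw [hterm] at key
    exact_mod_cast key

omit [DecidableEq G] in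
/-- **All characters of an index-`2^{k+1}·Πp_i^{a_i+1}` kernel at once**: for `H ∌ ρ` with `G/H` cyclic of order `2^{k+1}m`, `m = Πp_i^{a_i+1} > 1` odd, the
`φ(2^{k+1}m)` characters with kernel `H` vanish on `S` iff the coset counts of `S` have vanishing `k'`-th mixed differences along the `p₁⋯p_{k'}`-torsion of `G/H`
from every base point (so `H` contributes `φ(2^{k+1}m) = 2^k φ(m)` to Kubota's defect iff so). [cite: Kubota1965, §4 Lemma 2] [cite: Hazama2003CyclicCM, Thm. 4.8]
[cite: White1993SporadicCycles, §4, proof of Lemma 3 (p. 131)] [cite: LamLeung2000, Thm. 2.2] -/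
theorem forall_sum_char_eq_zero_iff_alternatingSum_of_index_two_pow_mul_primePowers (k : ℕ) {k' : ℕ} {p a : Fin k' → ℕ} (hk' : 0 < k')
    (hp : ∀ i, (p i).Prime) (hinj : Function.Injective p) (hodd : ∀ i, p i ≠ 2)
    (h : IsCMTypeWith ρ (Φ : Set G)) {H : Subgroup G} (hρH : ρ ∉ H) (hcyc : IsCyclic (G ⧸ H))
    (hidx : H.index = 2 ^ (k + 1) * ∏ i, p i ^ (a i + 1)) :
    (∀ χ : AddChar (Additive G) ℂ, (∀ g : G, χ (Additive.ofMul g) = 1 ↔ g ∈ H) →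
        ∑ s ∈ Φ, χ (Additive.ofMul s) = 0) ↔
      ∀ (g : G) (x : Fin k' → G), (∀ i, x i ^ p i ∈ H) →
        ∑ ε : Fin k' → Bool, (∏ i, (if ε i then (-1 : ℤ) else 1)) *
          ((Φ.filter fun s => (g * ∏ i, (if ε i then x i else 1))⁻¹ * s ∈ H).card : ℤ) = 0 := by
  have hρ2 := rho_mul_rho_tp h
  rw [forall_sum_char_eq_zero_iff_exists hρH hρ2 hcyc Φ]
  constructor
  · rintro ⟨ψ, hψ, h0⟩
    exact (sum_char_eq_zero_iff_alternatingSum_of_index_two_pow_mul_primePowers k hk' hp hinj hodd h ψ hρH hψ hidx hcyc).1 h0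
  · intro hsep
    obtain ⟨χ, -, hker⟩ := exists_oddChar_ker hρH hρ2 hcyc
    exact ⟨χ, hker, (sum_char_eq_zero_iff_alternatingSum_of_index_two_pow_mul_primePowers k hk' hp hinj hodd h χ hρH hker hidx hcyc).2 hsep⟩

end IndexTwoPowerOdd

/-! ## §3 The same criterion for prime families indexed by an arbitrary finite type: transport along `Fintype.equivFin` -/

section Fintype

/-- **Index `2^{k+1}·Π_i p_i^{a_i+1}`, family indexed by a finite type `ι`**: the criterion of
`sum_char_eq_zero_iff_alternatingSum_of_index_two_pow_mul_primePowers` for `p a : ι → ℕ` (pairwise distinct odd primes, `ι` nonempty) — the characters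
of kernel `H` vanish on `S` iff the `|ι|`-th mixed differences of the coset counts along admissible displacements vanish.  (Reindexing along
`ι ≃ Fin |ι|`; this is the form used with `ι = ↥n.primeFactors` below and with `ι = ↥J` for a set `J` of prime divisors of the exponent.)
[cite: Kubota1965, §4 Lemma 2] [cite: Hazama2003CyclicCM, Lemma 4.6.1 and Thm. 4.8] [cite: LamLeung2000, Thm. 2.2] -/
theorem sum_char_eq_zero_iff_alternatingSum_of_index_two_pow_mul_primePowers_fintype (k : ℕ) {ι : Type*} [Fintype ι] [DecidableEq ι]
    {p a : ι → ℕ} (hne : Nonempty ι) (hp : ∀ i, (p i).Prime) (hinj : Function.Injective p) (hodd : ∀ i, p i ≠ 2)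
    (h : IsCMTypeWith ρ (Φ : Set G)) (χ : AddChar (Additive G) ℂ) {H : Subgroup G} (hρH : ρ ∉ H)
    (hker : ∀ g : G, χ (Additive.ofMul g) = 1 ↔ g ∈ H) (hidx : H.index = 2 ^ (k + 1) * ∏ i, p i ^ (a i + 1)) (hcyc : IsCyclic (G ⧸ H)) :
    ∑ s ∈ Φ, χ (Additive.ofMul s) = 0 ↔ ∀ (g : G) (x : ι → G), (∀ i, x i ^ p i ∈ H) →
      ∑ ε : ι → Bool, (∏ i, (if ε i then (-1 : ℤ) else 1)) *
        ((Φ.filter fun s => (g * ∏ i, (if ε i then x i else 1))⁻¹ * s ∈ H).card : ℤ) = 0 := by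
  set kk : ℕ := Fintype.card ι with hkk
  set e : ι ≃ Fin kk := Fintype.equivFin ι with he
  have hk0 : 0 < kk := Fintype.card_pos_iff.2 hne
  have hidx' : H.index = 2 ^ (k + 1) * ∏ i : Fin kk, (p ∘ e.symm) i ^ ((a ∘ e.symm) i + 1) := by
    rw [hidx, Function.comp_def, Function.comp_def, Equiv.prod_comp e.symm (fun j => p j ^ (a j + 1))]
  rw [sum_char_eq_zero_iff_alternatingSum_of_index_two_pow_mul_primePowers k hk0 (fun i => hp (e.symm i))
    (hinj.comp e.symm.injective) (fun i => hodd (e.symm i)) h χ hρH hker hidx' hcyc]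
  -- reindex the criterion along `e`
  have hre : ∀ (g : G) (x : ι → G),
      (∑ ε : Fin kk → Bool, (∏ i, (if ε i then (-1 : ℤ) else 1)) *
          ((Φ.filter fun s => (g * ∏ i, (if ε i then x (e.symm i) else 1))⁻¹ * s ∈ H).card : ℤ)) =
        ∑ ε : ι → Bool, (∏ i, (if ε i then (-1 : ℤ) else 1)) *
          ((Φ.filter fun s => (g * ∏ i, (if ε i then x i else 1))⁻¹ * s ∈ H).card : ℤ) := by
    intro g x
    rw [← Equiv.sum_comp (e.arrowCongr (Equiv.refl Bool))]
    refine Finset.sum_congr rfl fun ε _ => ?_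
    have hε : ∀ i : Fin kk, (e.arrowCongr (Equiv.refl Bool) ε) i = ε (e.symm i) := fun i => rfl
    simp_rw [hε]
    rw [Equiv.prod_comp e.symm (fun j => if ε j then (-1 : ℤ) else 1),
      Equiv.prod_comp e.symm (fun j => if ε j then x j else 1)]
  constructor
  · intro hfin g x hx
    rw [← hre]
    exact hfin g (fun i => x (e.symm i)) fun i => hx (e.symm i)
  · intro hι g x hx
    have h1 := hι g (fun j => x (e j)) fun j => by simpa only [Equiv.symm_apply_apply] using hx (e j)
    rw [← hre] at h1
    simp only [Equiv.apply_symm_apply] at h1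
    exact h1

omit [DecidableEq G] in
/-- **All characters at once, family indexed by a finite type** (index `2^{k+1}·Π_i p_i^{a_i+1}`). [cite: Kubota1965, §4 Lemma 2]
[cite: Hazama2003CyclicCM, Thm. 4.8] [cite: White1993SporadicCycles, §4, proof of Lemma 3 (p. 131)] -/
theorem forall_sum_char_eq_zero_iff_alternatingSum_of_index_two_pow_mul_primePowers_fintype (k : ℕ) {ι : Type*} [Fintype ι] [DecidableEq ι]
    {p a : ι → ℕ} (hne : Nonempty ι) (hp : ∀ i, (p i).Prime) (hinj : Function.Injective p) (hodd : ∀ i, p i ≠ 2)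
    (h : IsCMTypeWith ρ (Φ : Set G)) {H : Subgroup G} (hρH : ρ ∉ H) (hcyc : IsCyclic (G ⧸ H))
    (hidx : H.index = 2 ^ (k + 1) * ∏ i, p i ^ (a i + 1)) :
    (∀ χ : AddChar (Additive G) ℂ, (∀ g : G, χ (Additive.ofMul g) = 1 ↔ g ∈ H) →
        ∑ s ∈ Φ, χ (Additive.ofMul s) = 0) ↔
      ∀ (g : G) (x : ι → G), (∀ i, x i ^ p i ∈ H) →
        ∑ ε : ι → Bool, (∏ i, (if ε i then (-1 : ℤ) else 1)) *
          ((Φ.filter fun s => (g * ∏ i, (if ε i then x i else 1))⁻¹ * s ∈ H).card : ℤ) = 0 := by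
  have hρ2 := rho_mul_rho_tp h
  rw [forall_sum_char_eq_zero_iff_exists hρH hρ2 hcyc Φ]
  constructor
  · rintro ⟨ψ, hψ, h0⟩
    exact (sum_char_eq_zero_iff_alternatingSum_of_index_two_pow_mul_primePowers_fintype k hne hp hinj hodd h ψ hρH hψ hidx hcyc).1 h0
  · intro hsep
    obtain ⟨χ, -, hker⟩ := exists_oddChar_ker hρH hρ2 hcyc
    exact ⟨χ, hker, (sum_char_eq_zero_iff_alternatingSum_of_index_two_pow_mul_primePowers_fintype k hne hp hinj hodd h χ hρH hker hidx hcyc).2 hsep⟩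

end Fintype

/-! ## §4 The form indexed by the prime divisors of the odd part: `[G:H] = 2^{k+1}·n`, `n > 1` odd, `G/H` cyclic — the input of the rank formulas -/

section OddPart

/-- **VANISHING AT A KERNEL OF INDEX `2^{k+1}n`, `n > 1` ODD, CYCLIC QUOTIENT**: `χ(S) = 0` iff for every `g ∈ G` and every family `(x_q)_{q ∣ n prime}`
with `x_q^q ∈ H` the mixed difference `Σ_{ε ∈ {0,1}^{primes of n}} (−1)^{|ε|} #(S ∩ g·Π_q x_q^{ε_q}·H)` vanishes (the family form of
`sum_char_eq_zero_iff_alternatingSum_of_index_two_pow_mul_primePowers` with `ι = ↥n.primeFactors`, `p_q = q`, `a_q + 1 = v_q(n)`,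
`n = Π_q q^{v_q(n)}`). [cite: Kubota1965, §4 Lemma 2] [cite: Hazama2003CyclicCM, Prop. 4.1, Lemma 4.6.1, Thm. 4.8] [cite: LamLeung2000, Thm. 2.2] -/
theorem sum_char_eq_zero_iff_alternatingSum_of_index_two_pow_mul_odd (k : ℕ) {n : ℕ} (hn1 : n ≠ 1) (hn2 : ¬ 2 ∣ n)
    (h : IsCMTypeWith ρ (Φ : Set G)) (χ : AddChar (Additive G) ℂ) {H : Subgroup G} (hρH : ρ ∉ H)
    (hker : ∀ g : G, χ (Additive.ofMul g) = 1 ↔ g ∈ H) (hidx : H.index = 2 ^ (k + 1) * n) (hcyc : IsCyclic (G ⧸ H)) :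
    ∑ s ∈ Φ, χ (Additive.ofMul s) = 0 ↔ ∀ (g : G) (x : ↥n.primeFactors → G), (∀ q, x q ^ (q : ℕ) ∈ H) →
      ∑ ε : ↥n.primeFactors → Bool, (∏ q, (if ε q then (-1 : ℤ) else 1)) *
        ((Φ.filter fun s => (g * ∏ q, (if ε q then x q else 1))⁻¹ * s ∈ H).card : ℤ) = 0 := by
  have hn0 : n ≠ 0 := by
    rintro rfl
    exact hn2 (dvd_zero 2)
  have hne : Nonempty ↥n.primeFactors := by
    obtain ⟨q, hq⟩ := Nat.nonempty_primeFactors.2 (lt_of_le_of_ne (Nat.one_le_iff_ne_zero.2 hn0) (Ne.symm hn1))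
    exact ⟨⟨q, hq⟩⟩
  have hprod : ∏ q ∈ n.primeFactors, q ^ n.factorization q = n := by
    rw [← Nat.prod_factorization_eq_prod_primeFactors (fun q m => q ^ m)]
    exact Nat.prod_factorization_pow_eq_self hn0
  have hidx' : H.index = 2 ^ (k + 1) * ∏ q : ↥n.primeFactors, (q : ℕ) ^ ((n.factorization q - 1) + 1) := by
    rw [hidx, Finset.prod_coe_sort n.primeFactors (fun q : ℕ => q ^ ((n.factorization q - 1) + 1))]
    congr 1
    conv_lhs => rw [← hprod]
    refine Finset.prod_congr rfl fun q hq => ?_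
    rw [Nat.sub_add_cancel (Nat.one_le_iff_ne_zero.2
      ((Nat.prime_of_mem_primeFactors hq).factorization_pos_of_dvd hn0 (Nat.dvd_of_mem_primeFactors hq)).ne')]
  exact sum_char_eq_zero_iff_alternatingSum_of_index_two_pow_mul_primePowers_fintype k hne
    (fun q => Nat.prime_of_mem_primeFactors q.2) Subtype.val_injective
    (fun q h2 => hn2 (h2 ▸ Nat.dvd_of_mem_primeFactors q.2)) h χ hρH hker hidx' hcyc

omit [DecidableEq G] in
/-- **All characters of an index-`2^{k+1}n` kernel at once** (`n > 1` odd, `G/H` cyclic, `H ∌ ρ`): the `φ(2^{k+1}n)` characters with kernel `H` vanish on `S`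
iff the coset counts of `S` have vanishing mixed differences along every family `(x_q)_{q ∣ n prime}`, `x_q^q ∈ H` — so `H` contributes
`2^k φ(n)` to Kubota's defect iff so. [cite: Kubota1965, §4 Lemma 2] [cite: Hazama2003CyclicCM, Thm. 4.8]
[cite: White1993SporadicCycles, §4, proof of Lemma 3 (p. 131)] [cite: LamLeung2000, Thm. 2.2] -/
theorem forall_sum_char_eq_zero_iff_alternatingSum_of_index_two_pow_mul_odd (k : ℕ) {n : ℕ} (hn1 : n ≠ 1) (hn2 : ¬ 2 ∣ n)
    (h : IsCMTypeWith ρ (Φ : Set G)) {H : Subgroup G} (hρH : ρ ∉ H) (hcyc : IsCyclic (G ⧸ H)) (hidx : H.index = 2 ^ (k + 1) * n) :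
    (∀ χ : AddChar (Additive G) ℂ, (∀ g : G, χ (Additive.ofMul g) = 1 ↔ g ∈ H) →
        ∑ s ∈ Φ, χ (Additive.ofMul s) = 0) ↔
      ∀ (g : G) (x : ↥n.primeFactors → G), (∀ q, x q ^ (q : ℕ) ∈ H) →
        ∑ ε : ↥n.primeFactors → Bool, (∏ q, (if ε q then (-1 : ℤ) else 1)) *
          ((Φ.filter fun s => (g * ∏ q, (if ε q then x q else 1))⁻¹ * s ∈ H).card : ℤ) = 0 := by
  have hρ2 := rho_mul_rho_tp h
  rw [forall_sum_char_eq_zero_iff_exists hρH hρ2 hcyc Φ]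
  constructor
  · rintro ⟨ψ, hψ, h0⟩
    exact (sum_char_eq_zero_iff_alternatingSum_of_index_two_pow_mul_odd k hn1 hn2 h ψ hρH hψ hidx hcyc).1 h0
  · intro hsep
    obtain ⟨χ, -, hker⟩ := exists_oddChar_ker hρH hρ2 hcyc
    exact ⟨χ, hker, (sum_char_eq_zero_iff_alternatingSum_of_index_two_pow_mul_odd k hn1 hn2 h χ hρH hker hidx hcyc).2 hsep⟩

end OddPart

end AbelianKernels

end CyclicCMType

end Literature.NumberTheory.ComplexMultiplication

end
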